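import Literature.IUT.LogThetaLattice.HodgeTheaterLogLink
import HarnessLib

/-!
# [IUTchIII] Proposition 1.3 (ii): the strip log-links of a log-link of Hodge theaters are DETERMINED by the
# poly-isomorphism of `D`-Hodge theaters they lie over (proof-only companion of `HodgeTheaterLogLink.lean`)

S. Mochizuki, *Inter-universal Teichmüller Theory III*, kurims manuscript (May 2020), §1, Proposition 1.3
(i), (ii), p. 42 [claim: Mochizuki2012, status: disputed]:

* (i) "… the poly-isomorphism determined by `Ξ` between the `D`-prime-strips associated to `†F_□`, `‡F_□`
  uniquely determines a poly-isomorphism `log(†F_□) ⥲ ‡F_□` [cf. Definition 1.1, (iii); [IUTchI],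
  Corollary 5.3, (ii)], hence a log-link `†F_□ --log--> ‡F_□` … When `Ξ` is replaced by a poly-isomorphism
  `†HT^{D-Θ±ellNF} ⥲ ‡HT^{D-Θ±ellNF}`, we shall also refer to the resulting collection of log-links [i.e.,
  corresponding to each constituent isomorphism of the poly-isomorphism `Ξ`] as a log-link …";
* (ii) "(Coricity) Any log-link `†HT^{Θ±ellNF} --log--> ‡HT^{Θ±ellNF}` induces [and may be thought of as
  "lying over"] a [poly-]isomorphism `†HT^{D-Θ±ellNF} ⥲ ‡HT^{D-Θ±ellNF}` of `D-Θ^{±ell}NF`-Hodge theaters [and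
  indeed coincides with the log-link constructed in (i) from this [poly-]isomorphism of
  `D-Θ^{±ell}NF`-Hodge theaters]."

Printed proof (p. 43): "The various assertions of Proposition 1.3 follow immediately from the definitions
and the references quoted in the statements of these assertions."

The typing of record (abc-iut-L6-t3, `HodgeTheaterLogLink.lean`) DEFINES a log-link of `Θ^{±ell}NF`-Hodge
theaters as the datum `Ξ` (`HTLogLink`) and DERIVES the log-links of the constituent `F`-prime-strips
(`HTLogLink.stripLink`: one constituent `stripLogIso L ξ □` per `ξ ∈ Ξ`); there Prop 1.3 (ii) is
`inducedDHT := Ξ` and `eq_of_inducedDHT` is `rfl`. THIS PROOF-ONLY FILE (abc-iut cell, wave 4, CONE-BOARD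
row IUTchIII:Prop1.3(ii); no definition, no new `Prop`, the typer's file untouched) supplies the content of
the bracket "[and indeed coincides with the log-link constructed in (i) from this [poly-]isomorphism]" at
the level where it is NOT definitional — the constituent `F`-prime-strips — and thereby certifies that the
typing loses nothing by recording `Ξ` alone:

* `HTLogLink.mem_stripLink_polyIso_iff` — an isomorphism `φ : log(†F_□) ⥲ ‡F_□` is a constituent of the
  derived log-link iff it LIES OVER a constituent of `Ξ` (`D(φ) = D(log †F_□) = †D_□ ⥲^{D(ξ)_□} ‡D_□`);
* **`HTLogLink.stripLink_eq_of_inducedD`** — ANY log-link of `F`-prime-strips `ℓ : †F_□ --log--> ‡F_□` whose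
  induced poly-isomorphism of `D`-prime-strips (Prop 1.2 (i), `LogLink.inducedD`) is the class
  `{D(ξ)_□ | ξ ∈ Ξ}` IS the derived `Λ.stripLink □` — uniqueness from the rigidity [IUTchI] Cor 5.3 (ii)
  (`StripFrame.toD_isoBij`, through t3's `stripLogIso_unique`); with t3's `stripLink_inducedD` this is an
  `iff` (`stripLink_eq_iff_inducedD`), and a family of strip log-links lying over `Ξ` at every label is
  the derived family (`stripLinks_eq_of_inducedD`);
* Prop 1.3 (i) "corresponding to each constituent isomorphism of the poly-isomorphism `Ξ`":
  `stripLink_polyIso_eq_iUnion_ofIso` (the derived log-link is the union of the single-`ξ` ones),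
  `stripLink_ofIso` / `inducedD_stripLink_ofIso` (for a single `ξ`: one constituent, lying over exactly
  `D(ξ)_□`), `stripLink_mono` (more constituents of `Ξ`, more constituents of the strip log-link).

Honest framing: bookkeeping over the interfaces `StripFrame` / `LogStripData` ([IUTchI] Cor 5.3 (ii) is the
frame field `toD_isoBij`; typed ≠ discharged); nothing here asserts a disputed claim or takes a side on
[IUTchIII] Cor. 3.12. Deliberately NOT here: Prop 1.3 (iii) ("properties corresponding to Prop 1.2
(ii)–(ix) for each `†F_□`"), which at the interface level is Prop 1.2 (ii)–(ix) strip by strip (concrete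
content in `HolomorphicLogShells*.lean`, `BiCores*.lean`); Prop 1.3 (i)/(iv) beyond the above (in the typer's
file: `stripLogIso_unique`, `HTLogLink.Chain`).
-/

namespace Literature.IUT.LogThetaLattice

open CategoryTheory
open Literature.IUT.HodgeTheaters

universe u

namespace HTLogLink

variable {S : StripFrame.{u}} (L : LogStripData S) {X Y : S.HT}

/-- **IUTchIII:Prop1.3(ii)** (kurims p.42) "lying over": an isomorphism `φ : log(†F_□) ⥲ ‡F_□` is a
constituent of the strip log-link `†F_□ --log--> ‡F_□` derived from `Ξ` (Prop 1.3 (i)) iff its image on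
`D`-prime-strips, read through `D(log †F_□) = †D_□` (Rmk 1.1.2 (i)), is `D(ξ)_□` for some constituent `ξ ∈ Ξ`
— the "uniquely determines" of [IUTchI] Cor 5.3 (ii) (`stripLogIso_unique`) in membership form.
[claim: Mochizuki2012, status: disputed] -/
theorem mem_stripLink_polyIso_iff (Λ : HTLogLink L X Y) (l : S.Label)
    (φ : L.log.obj ((S.strip l).obj X) ≅ (S.strip l).obj Y) :
    φ ∈ (Λ.stripLink l).polyIso ↔ ∃ ξ ∈ Λ.Ξ, S.toD.mapIso φ = L.logDIso _ ≪≫ dstripIso ξ l := by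
  simp only [stripLink, Set.mem_image]
  constructor
  · rintro ⟨ξ, hξ, rfl⟩
    exact ⟨ξ, hξ, mapIso_stripLogIso L ξ l⟩
  · rintro ⟨ξ, hξ, h⟩
    exact ⟨ξ, hξ, (stripLogIso_unique L ξ l φ h).symm⟩

/-- **IUTchIII:Prop1.3(ii)** (kurims p.42) **"and indeed COINCIDES with the log-link constructed in (i) from
this [poly-]isomorphism"**, at the constituent `F`-prime-strips: ANY log-link `ℓ : †F_□ --log--> ‡F_□`
(Def 1.1 (iii)) whose induced poly-isomorphism of `D`-prime-strips `†D_□ ⥲ ‡D_□` (Prop 1.2 (i)) is the class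
`{D(ξ)_□ | ξ ∈ Ξ}` determined by `Ξ` IS the strip log-link of Prop 1.3 (i) — rigidity [IUTchI] Cor 5.3 (ii)
("`Isom(¹F, ²F) → Isom(¹D, ²D)` is bijective", frame field `toD_isoBij`). [claim: Mochizuki2012, status: disputed] -/
theorem stripLink_eq_of_inducedD (Λ : HTLogLink L X Y) (l : S.Label)
    (ℓ : LogLink L ((S.strip l).obj X) ((S.strip l).obj Y))
    (h : ℓ.inducedD = (fun ξ => dstripIso ξ l) '' Λ.Ξ) : ℓ = Λ.stripLink l := by
  apply LogLink.ext
  ext φ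
  rw [mem_stripLink_polyIso_iff]
  constructor
  · intro hφ
    have hmem : (L.logDIso _).symm ≪≫ S.toD.mapIso φ ∈ ℓ.inducedD := ⟨φ, hφ, rfl⟩
    rw [h] at hmem
    obtain ⟨ξ, hξ, e⟩ := hmem
    have e' : dstripIso ξ l = (L.logDIso _).symm ≪≫ S.toD.mapIso φ := e
    refine ⟨ξ, hξ, ?_⟩
    rw [e', ← Iso.trans_assoc, Iso.self_symm_id, Iso.refl_trans]
  · rintro ⟨ξ, hξ, hφ⟩
    have hmem : dstripIso ξ l ∈ ℓ.inducedD := by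
      rw [h]
      exact ⟨ξ, hξ, rfl⟩
    obtain ⟨ψ, hψ, e⟩ := (ℓ.mem_inducedD _).mp hmem
    have hψ' : S.toD.mapIso ψ = L.logDIso _ ≪≫ dstripIso ξ l := by
      rw [← e, ← Iso.trans_assoc, Iso.self_symm_id, Iso.refl_trans]
    rw [(stripLogIso_unique L ξ l φ hφ).trans (stripLogIso_unique L ξ l ψ hψ').symm]
    exact hψ

/-- **IUTchIII:Prop1.3(ii)** (kurims p.42) the same as a characterisation: a log-link of `F`-prime-strips
`†F_□ --log--> ‡F_□` is the one derived from `Ξ` IF AND ONLY IF it lies over `Ξ` (its induced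
`D`-poly-isomorphism is `{D(ξ)_□ | ξ ∈ Ξ}`; the "only if" is t3's `stripLink_inducedD`).
[claim: Mochizuki2012, status: disputed] -/
theorem stripLink_eq_iff_inducedD (Λ : HTLogLink L X Y) (l : S.Label)
    (ℓ : LogLink L ((S.strip l).obj X) ((S.strip l).obj Y)) :
    ℓ = Λ.stripLink l ↔ ℓ.inducedD = (fun ξ => dstripIso ξ l) '' Λ.Ξ := by
  refine ⟨fun h => ?_, stripLink_eq_of_inducedD L Λ l ℓ⟩
  rw [h]
  exact Λ.stripLink_inducedD l

/-- **IUTchIII:Prop1.3(ii)** (kurims p.42) for the whole "collection of log-links `†F_□ --log--> ‡F_□`, as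
`□` ranges over all possibilities" (Prop 1.3 (i)): a family of strip log-links, one per label, each lying
over `Ξ`, IS the family derived from `Ξ` — so the log-link of Hodge theaters is faithfully recorded by `Ξ`
alone (the design of `HTLogLink`). [claim: Mochizuki2012, status: disputed] -/
theorem stripLinks_eq_of_inducedD (Λ : HTLogLink L X Y)
    (ℓ : ∀ l : S.Label, LogLink L ((S.strip l).obj X) ((S.strip l).obj Y))
    (h : ∀ l, (ℓ l).inducedD = (fun ξ => dstripIso ξ l) '' Λ.Ξ) : ℓ = Λ.stripLink :=
  funext fun l => stripLink_eq_of_inducedD L Λ l (ℓ l) (h l)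

/-! ### Prop 1.3 (i): "corresponding to each constituent isomorphism of the poly-isomorphism `Ξ`" -/

/-- **IUTchIII:Prop1.3(i)** (kurims p.42) for a SINGLE `ξ` (Rmk 1.3.1) the derived strip log-link at `□` is
the log-link consisting of the one isomorphism `stripLogIso L ξ □ : log(†F_□) ⥲ ‡F_□`.
[claim: Mochizuki2012, status: disputed] -/
theorem stripLink_ofIso (ξ : S.htToD.obj X ≅ S.htToD.obj Y) (l : S.Label) :
    (ofIso L ξ).stripLink l = LogLink.ofIso L (stripLogIso L ξ l) := by
  apply LogLink.ext
  simp only [stripLink, ofIso, LogLink.ofIso, PolyIso.single, Set.image_singleton]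

/-- **IUTchIII:Prop1.3(ii)** (kurims p.42) for a single `ξ`: the derived strip log-link lies over EXACTLY the
isomorphism `D(ξ)_□ : †D_□ ⥲ ‡D_□` (its induced `D`-poly-isomorphism is the single `dstripIso ξ □`).
[claim: Mochizuki2012, status: disputed] -/
theorem inducedD_stripLink_ofIso (ξ : S.htToD.obj X ≅ S.htToD.obj Y) (l : S.Label) :
    ((ofIso L ξ).stripLink l).inducedD = PolyIso.single (dstripIso ξ l) := by
  rw [stripLink_inducedD]
  simp only [ofIso, PolyIso.single, Set.image_singleton]

/-- **IUTchIII:Prop1.3(i)** (kurims p.42) "When `Ξ` is replaced by a poly-isomorphism … the resulting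
collection of log-links [i.e., corresponding to each constituent isomorphism of the poly-isomorphism `Ξ`]":
the strip log-link derived from `Ξ` is the union, over the constituents `ξ ∈ Ξ`, of the single-`ξ` ones.
[claim: Mochizuki2012, status: disputed] -/
theorem stripLink_polyIso_eq_iUnion_ofIso (Λ : HTLogLink L X Y) (l : S.Label) :
    (Λ.stripLink l).polyIso = ⋃ ξ ∈ Λ.Ξ, ((ofIso L ξ).stripLink l).polyIso := by
  ext φ
  simp only [Set.mem_iUnion]
  constructor
  · rintro ⟨ξ, hξ, rfl⟩
    exact ⟨ξ, hξ, ξ, PolyIso.mem_single.mpr rfl, rfl⟩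
  · rintro ⟨ξ, hξ, ξ', hξ', rfl⟩
    obtain rfl : ξ' = ξ := PolyIso.mem_single.mp hξ'
    exact ⟨ξ', hξ, rfl⟩

/-- **IUTchIII:Prop1.3(i)** (kurims p.42) monotonicity in `Ξ`: enlarging the poly-isomorphism of `D`-Hodge
theaters enlarges each derived strip log-link (one constituent per constituent of `Ξ`).
[claim: Mochizuki2012, status: disputed] -/
theorem stripLink_mono {Λ Λ' : HTLogLink L X Y} (h : Λ.Ξ ⊆ Λ'.Ξ) (l : S.Label) :
    (Λ.stripLink l).polyIso ⊆ (Λ'.stripLink l).polyIso :=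
  Set.image_mono h

/-- **IUTchIII:Prop1.3(i)** (kurims p.42) in particular every strip log-link derived from `Ξ` is contained
in the one derived from the FULL poly-isomorphism (the full log-link, Def 1.4's vertical arrows).
[claim: Mochizuki2012, status: disputed] -/
theorem stripLink_polyIso_subset_full (Λ : HTLogLink L X Y) (l : S.Label) :
    (Λ.stripLink l).polyIso ⊆ ((full L X Y).stripLink l).polyIso :=
  stripLink_mono L (Set.subset_univ _) l

end HTLogLink

end Literature.IUT.LogThetaLattice
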